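import Mathlib
import Literature.NumberTheory.LFunctions.Zhang2022.Section17InnerChiIdentities
import Literature.NumberTheory.LFunctions.Zhang2022.Section13MeanSquareTools
import Literature.NumberTheory.LFunctions.Zhang2022.TypedSection17NuStarBound
import HarnessLib

/-!
# Zhang (2022) §17 p. 97, toward §17.u011: the LOSS-FREE mean value of the Dirichlet-polynomial factor
# `H(s,ψ) = B(s,ψ)G(s,ψ)N(s+β₂,ψ)N(s+β₃,ψ)·F(1−s,ψ̄)` of `𝔨₃(s,ψ)ω(s)` over `ψ ∈ Ψ₁`, near the
# critical line

Topic `Literature/NumberTheory/LFunctions/Zhang2022` (Landau–Siegel audit tree; verdict-neutral).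
Y. Zhang, *Discrete mean estimates and the Landau–Siegel zero*, arXiv:2211.02515v1 (2022)
[Zhang2022LandauSiegel] — **an unrefereed manuscript under adjudication; nothing here asserts or
denies its Theorems 1–2.** §17 p. 97 (tex L4775), the step `Z22:§17.u011`:

> "Thus, in a way similar to the proof of (15.4),
> `Σ_{ψ∈Ψ₁}(p_ψt₀)^{β₃}I₄⁻(ψ) = Σ_{ψ∈Ψ₁}(p_ψt₀)^{β₂}(1/2πi)∫_{𝔍(−α)}𝔨₃*(s,ψ)ω(s)ds + o(𝔓)`."

The two integrands differ, on `𝔍(−α)`, by the Lemma-5.1 reflection error of §17.u010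
(`(pt₀)^{β₃}𝔨₃ − (pt₀)^{β₂}𝔨₃* = (pt₀)^{β₃}(L(s+β₁,ψ)/L(s,ψ) − M)·H`, `M = (pt₀)^{−β₁}L(1−s−β₁,ψ̄)/L(1−s,ψ̄)`,
`H = B(s,ψ)G(s,ψ)N(s+β₂,ψ)N(s+β₃,ψ)F(1−s,ψ̄)`), so u011 reduces to a MEAN VALUE of `‖H(s,ψ)‖` over
`ψ ∈ Ψ₁`, uniformly along `𝔍(−α)`. This file supplies that mean value by the first assertion of
Lemma 3.3 ("by the orthogonality relation", tree `Skeleton.lemma33a_sum_le`; packaged near the critical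
line as `Typed.Section13.meanSq_floorP_le`) — loss-free against `#Ψ ≍ 𝔓` — and the cell's block
calculus for logarithmic mean squares (`Section17MeanSquareMajorant`: `Dom`, `IsBlock`, `smoothIndLE`,
`sum_norm_sq_div_le_of_dom`; `Section13MeanSquareTools`):

* `dom_nuOneStar` — `ν₁* = υ·[≤D⁴] ∗ (n^{−β₂}g*(T²/n)) ∗ (n^{−β₃}g*(T²/n)) ≪ 1·((τ₂·𝟙_{≤D⁴}) ∗ 𝟙_{≤y} ∗ 𝟙_{≤y})`,
  `y = ⌈2T²⌉` (a factor supported on `n ≤ y` costs `log y = O(𝓛^{1.1})`, not `log P = 𝓛⁹`);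
* `sum_norm_sq_bcoefChi_conv_nuOneStar_div_le` — for the χ-TWISTED coefficient
  `x = (bχ) ∗ ν₁*` of `B·G·N·N` (RT16-int-1; tree `step17_u015_chi`):
  `Σ_{n≤X}|x(n)|²/n ≤ K_ι²·majorantConst 36 14·(log X)⁴(log y)²⁰(log D⁴)¹²`, `K_ι = (1+|ι₂|)(|ι₃|+|ι₄|)`
  (block `τ₂ ∗ (τ₂·𝟙_{≤D⁴}) ∗ 𝟙_{≤y} ∗ 𝟙_{≤y}`, degree `7`, prime values `2 + 2[p≤D⁴] + 2[p≤y]`,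
  squared `≤ 4 + 20[p≤y] + 12[p≤D⁴]`);
* `bcoefChi_conv_nuOneStar_eq_zero_of_floor_lt`, `BGNN_eq_sum_Icc` — `x` is supported on `n ≤ ⌊P⌋`
  once `𝓛 ≥ 4` (`supp b < P^{1/2}max(P₂,P₃) = PT⁻¹⁰` as `P₃ ≤ P₂`, `supp ν₁* < 4(D⁴+1)T⁴`, and
  `4(D⁴+1) ≤ D⁶ ≤ T⁶`), so `B·G·N(s+β₂)·N(s+β₃) = Σ_{n≤⌊P⌋} x(n)ψ(n)n^{−s}` — the shape of Lemma 3.3 (i);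
* `meanSq_BGNN_le`, `meanSq_FpolyBar_le` — for any finite `T ⊆ Ψ` and `|Re s − ½| ≤ 2α`,
  `Σ_{ψ∈T}|BGNN(s,ψ)|² ≤ e^{8π}𝔓·K_ι²·majorantConst 36 14·(log⌊P⌋)⁴(log y)²⁰(log D⁴)¹²` and
  `Σ_{ψ∈T}|F(w,ψ̄)|² ≤ e^{8π}𝔓·majorantConst 4 4·(log⌊P⌋)⁴` (`|Re w − ½| ≤ 2α`; `F(w,ψ̄)` is the
  conjugate of the `ψ`-polynomial with coefficients `conj ν(n)`, `ν ≪ τ₂`);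
* `sum_norm_BGNN_mul_FpolyBar_le` — Cauchy–Schwarz: `Σ_{ψ∈T}|BGNN(s,ψ)|·|F(w,ψ̄)| ≤
  e^{8π}𝔓·K_ι·√(majorantConst 36 14·majorantConst 4 4)·(log⌊P⌋)⁴(log y)¹⁰(log D⁴)⁶`.

Theorems only (no definitions, no named facts; standard axioms). ZHANG-L discharge lane (WP16, seat
zl-w16-p7 as helper of zl-w16-p3 under the leaf `Typed.Section17.Eq17_9Rel`); the consumer is the
u011 file `Section17Step17u011`. WHAT THIS IS NOT: any claim about (17.7)–(17.10), Theorems 1–2 of the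
source, or Landau–Siegel zeros.

## References

* Y. Zhang, arXiv:2211.02515v1 (2022), §17 p. 97 (tex L4770–L4780); §3 Lemma 3.3 p. 12; §15 (15.2)
  p. 79; §6 Lemma 6.1 p. 30. [cite: Zhang2022LandauSiegel, §17 p. 97]
-/

noncomputable section

open Complex Real Finset ComplexConjugate
open scoped LSeries.notation

namespace Literature.NumberTheory.LFunctions.Zhang2022.Typed.Section17

open Literature.NumberTheory.LFunctions.Zhang2022
open Skeleton MeanSquareMajorant ArithmeticFunction

/-! ## The coefficient `ν₁*` and the twisted coefficient `(bχ) ∗ ν₁*` are block-dominated -/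

section Domination

variable (c' : ℝ) {D : ℕ} (χ : DirichletCharacter ℂ D)

omit χ in
/-- The cell's `seqConv` is Mathlib's Dirichlet convolution `⍟`. [folklore] -/
private theorem seqConv_eq_convolution (u v : ℕ → ℂ) : seqConv u v = u ⍟ v := by
  funext n
  rw [LSeries.convolution_def]
  rfl

omit χ in
/-- `Re β₂ = Re β₃ = 0` ((2.13)). [cite: Zhang2022LandauSiegel, §2 (2.13)] -/
private theorem beta23_re : (beta2 c' D).re = 0 ∧ (beta3 c' D).re = 0 := by
  constructor
  · simp [beta2]
  · simp [beta3]

omit χ in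
/-- **`n^{−β}g*(T²/n) ≪ 1·𝟙_{≤⌈2T²⌉}`** for a purely imaginary `β` (`|·| ≤ 1`, support `n < 2T²`;
`𝓛 > 0`). [cite: Zhang2022LandauSiegel, §6 Lemma 6.1 p.30; §17 u014 p.97] -/
theorem dom_nN (hℓ : 0 < ell D) {β : ℂ} (hβ : β.re = 0) :
    Dom (nN D β) 1 (smoothIndLE ⌈2 * bigT D ^ 2⌉₊) := by
  refine dom_smoothIndLE_of_support zero_le_one (fun n _ => Phi3Eval.norm_nN_le_one hℓ hβ n)
    (fun n hn => nN_eq_zero_of_le D β ?_)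
  exact le_trans (Nat.le_ceil _) (by exact_mod_cast hn.le)

/-- **`υ·[≤D⁴] ≪ 1·(τ₂·𝟙_{≤D⁴})`** ((3.1) `|υ| ≤ τ₂`, support `n ≤ D⁴`).
[cite: Zhang2022LandauSiegel, §3 (3.1) p.12] -/
theorem dom_trunc_ups :
    Dom (trunc (D ^ 4) (ups χ)) 1 ((tau 2).pmul (smoothIndLE (D ^ 4))) := by
  refine dom_pmul_smoothIndLE_of_support zero_le_one (tau_nonneg 2) (fun n _ => ?_) (fun n hn => ?_)
  · rw [one_mul]; exact norm_trunc_ups_le χ n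
  · have : ¬ n ≤ D ^ 4 := not_le.mpr hn
    simp [trunc, this]

/-- **`ν₁* ≪ 1·((τ₂·𝟙_{≤D⁴}) ∗ 𝟙_{≤y} ∗ 𝟙_{≤y})`**, `y = ⌈2T²⌉` (`ν₁* = υ·[≤D⁴] ∗ nN β₂ ∗ nN β₃`,
§17.u014). [cite: Zhang2022LandauSiegel, §17 u014 p.97] -/
theorem dom_nuOneStar (hℓ : 0 < ell D) :
    Dom (nuOneStar c' χ) (1 * 1 * 1)
      ((tau 2).pmul (smoothIndLE (D ^ 4)) * smoothIndLE ⌈2 * bigT D ^ 2⌉₊ *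
        smoothIndLE ⌈2 * bigT D ^ 2⌉₊) := by
  obtain ⟨h2, h3⟩ := beta23_re c' (D := D)
  have h := dom_seqConv (dom_seqConv (dom_trunc_ups χ) (dom_nN hℓ h2)) (dom_nN hℓ h3)
  rw [seqConv_eq_convolution, seqConv_eq_convolution] at h
  exact h

/-- **`(bχ) ∗ ν₁* ≪ K_ι·(τ₂ ∗ (τ₂·𝟙_{≤D⁴}) ∗ 𝟙_{≤y} ∗ 𝟙_{≤y})`**, `K_ι = (1+|ι₂|)(|ι₃|+|ι₄|)`
(`bχ ≪ K_ιτ₂` by (15.2), `Typed.Section13.dom_bcoef_chi`; `𝓛 ≥ 2`).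
[cite: Zhang2022LandauSiegel, §15 (15.2) p.79; §17 u015 p.97] -/
theorem dom_bcoefChi_conv_nuOneStar [NeZero D] (hD : 2 ≤ Real.log D) (hℓ : 0 < ell D) :
    Dom ((fun n => bcoef D n * χ (n : ZMod D)) ⍟ nuOneStar c' χ)
      ((1 + ‖iota2‖) * (‖iota3‖ + ‖iota4‖) * (1 * 1 * 1))
      (tau 2 * ((tau 2).pmul (smoothIndLE (D ^ 4)) * smoothIndLE ⌈2 * bigT D ^ 2⌉₊ *
        smoothIndLE ⌈2 * bigT D ^ 2⌉₊)) := by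
  have h := dom_seqConv (Typed.Section13.dom_bcoef_chi χ hD) (dom_nuOneStar c' χ hℓ)
  rw [seqConv_eq_convolution] at h
  exact h

omit χ in
/-- The block `τ₂ ∗ (τ₂·𝟙_{≤z}) ∗ 𝟙_{≤y} ∗ 𝟙_{≤y}` has degree `7` and prime values
`2 + 2[p≤z] + [p≤y] + [p≤y]`. [folklore] -/
private theorem isBlock_xblock (z y : ℕ) :
    IsBlock (tau 2 * ((tau 2).pmul (smoothIndLE z) * smoothIndLE y * smoothIndLE y)) 7 ∧
      ∀ p, p.Prime → (tau 2 * ((tau 2).pmul (smoothIndLE z) * smoothIndLE y * smoothIndLE y)) p =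
        2 + (2 * cutInd z p + cutInd y p + cutInd y p) := by
  have h1 : IsBlock ((tau 2).pmul (smoothIndLE z)) 2 := (isBlock_tau 2).pmul_smoothIndLE z
  have h2 : IsBlock ((tau 2).pmul (smoothIndLE z) * smoothIndLE y) 3 := by
    simpa using h1.mul (isBlock_smoothIndLE y)
  have h3 : IsBlock ((tau 2).pmul (smoothIndLE z) * smoothIndLE y * smoothIndLE y) 4 := by
    simpa using h2.mul (isBlock_smoothIndLE y)
  refine ⟨by simpa using (isBlock_tau 2).mul h3, fun p hp => ?_⟩
  rw [(isBlock_tau 2).mul_prime h3 hp, h2.mul_prime (isBlock_smoothIndLE y) hp,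
    h1.mul_prime (isBlock_smoothIndLE y) hp, pmul_smoothIndLE_prime _ hp, smoothIndLE_prime hp,
    tau_prime 2 hp]
  push_cast
  ring

/-- **The logarithmic mean square of the twisted coefficient `x = (bχ) ∗ ν₁*`**: for `X ≥ 2`, `𝓛 ≥ 2`,
`Σ_{n≤X}|x(n)|²/n ≤ K_ι²·majorantConst 36 14·(log X)⁴·(log⌈2T²⌉)²⁰·(log D⁴)¹²` — the factor of full
length costs `(log X)⁴`, the short factors their own scales.
[cite: Zhang2022LandauSiegel, §17 p.97; §15 (15.2); §6 Lemma 6.1] -/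
theorem sum_norm_sq_bcoefChi_conv_nuOneStar_div_le [NeZero D] (hD : 2 ≤ Real.log D) (hℓ : 0 < ell D)
    (hD4 : 2 ≤ D ^ 4) (hy : 2 ≤ ⌈2 * bigT D ^ 2⌉₊) {X : ℕ} (hX : 2 ≤ X) :
    ∑ n ∈ Icc 1 X, ‖((fun n => bcoef D n * χ (n : ZMod D)) ⍟ nuOneStar c' χ) n‖ ^ 2 / n ≤
      ((1 + ‖iota2‖) * (‖iota3‖ + ‖iota4‖)) ^ 2 *
        (majorantConst 36 14 * (Real.log X ^ 4 * Real.log ⌈2 * bigT D ^ 2⌉₊ ^ 20 *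
          Real.log ((D ^ 4 : ℕ) : ℝ) ^ 12)) := by
  set y : ℕ := ⌈2 * bigT D ^ 2⌉₊ with hy_def
  obtain ⟨hblock, hprime⟩ := isBlock_xblock (D ^ 4) y
  have hdom := dom_bcoefChi_conv_nuOneStar c' χ hD hℓ
  rw [show (1 + ‖iota2‖) * (‖iota3‖ + ‖iota4‖) * (1 * 1 * 1) = (1 + ‖iota2‖) * (‖iota3‖ + ‖iota4‖)
    by ring] at hdom
  have hGp : ∀ p, p.Prime →
      (tau 2 * ((tau 2).pmul (smoothIndLE (D ^ 4)) * smoothIndLE y * smoothIndLE y)) p ^ 2 ≤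
        ((4 : ℕ) : ℝ) + ((20 : ℕ) : ℝ) * cutInd y p + ((12 : ℕ) : ℝ) * cutInd (D ^ 4) p +
          ((0 : ℕ) : ℝ) * (cutInd 0 p * (fun _ : ℕ => (0 : ℝ)) p) + 0 * Real.log p := by
    intro p hp
    rw [hprime p hp]
    rcases cutInd_zero_or_one y p with h | h <;> rcases cutInd_zero_or_one (D ^ 4) p with h' | h' <;>
      rw [h, h'] <;> norm_num
  have key := sum_norm_sq_div_le_of_dom hdom hblock le_rfl hy hD4 hGp hX
  refine key.trans (le_of_eq ?_)
  rw [scaleBound]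
  norm_num

end Domination

/-! ## The support of `(bχ) ∗ ν₁*` lies below `P`, and `BGNN` as a polynomial over `n ≤ ⌊P⌋` -/

section Support

variable (c' : ℝ) {D : ℕ} (χ : DirichletCharacter ℂ D)

omit χ in
/-- `P₃ ≤ P₂` once `𝓛 ≥ 4` (`P₃ = P^{0.498}`, `P₂ = P^{1/2}T⁻¹⁰`: `T¹⁰ = e^{10𝓛^{1.1}} ≤ e^{0.002𝓛⁹}`;
cf. `Sec12D.P3_le_P2`). [cite: Zhang2022LandauSiegel, §2 (2.21)–(2.22)] -/
theorem P3_le_P2_of_four_le (hℓ : 4 ≤ ell D) : Skeleton.P3 D ≤ Skeleton.P2 D := by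
  have hℓ1 : 1 ≤ ell D := by linarith
  have hP : 0 < bigP D := Real.exp_pos _
  have hT0 : 0 < bigT D := Real.exp_pos _
  have h11 : ell D ^ (1.1 : ℝ) ≤ ell D ^ 2 := by
    have := Real.rpow_le_rpow_of_exponent_le hℓ1 (by norm_num : (1.1 : ℝ) ≤ 2)
    rwa [Real.rpow_two] at this
  have h7 : (4 : ℝ) ^ 7 ≤ ell D ^ 7 := pow_le_pow_left₀ (by norm_num) hℓ 7
  have hkey : 10 * ell D ^ (1.1 : ℝ) ≤ 0.002 * ell D ^ 9 := by
    have : ell D ^ 9 = ell D ^ 2 * ell D ^ 7 := by ring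
    rw [this]; nlinarith
  have hT10 : bigT D ^ 10 = Real.exp (10 * ell D ^ (1.1 : ℝ)) := by
    rw [bigT, ← Real.exp_nat_mul]; norm_num
  have h002 : Real.exp (0.002 * ell D ^ 9) = bigP D ^ (0.002 : ℝ) := by
    rw [bigP, ← Real.exp_mul, mul_comm]
  rw [Skeleton.P3, Skeleton.P2, le_div_iff₀ (pow_pos hT0 10), hT10]
  calc bigP D ^ (0.498 : ℝ) * Real.exp (10 * ell D ^ (1.1 : ℝ))
      ≤ bigP D ^ (0.498 : ℝ) * Real.exp (0.002 * ell D ^ 9) :=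
        mul_le_mul_of_nonneg_left (Real.exp_le_exp.mpr hkey) (Real.rpow_nonneg hP.le _)
    _ = bigP D ^ (0.498 : ℝ) * bigP D ^ (0.002 : ℝ) := by rw [h002]
    _ = bigP D ^ (0.5 : ℝ) := by rw [← Real.rpow_add hP]; norm_num

omit χ in
/-- `4(D⁴+1)·T⁴·(P^{1/2}·max(P₂,P₃)) ≤ P` once `𝓛 ≥ 4` (`P^{1/2}P₂ = PT⁻¹⁰`, `4(D⁴+1) ≤ D⁶ ≤ T⁶`).
[cite: Zhang2022LandauSiegel, §2 (2.6), (2.21); §17 (17.8) p.98] -/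
theorem support_product_le_bigP (hD : 3 ≤ D) (hℓ : 4 ≤ ell D) :
    bigP D ^ (1 / 2 : ℝ) * max (Skeleton.P2 D) (Skeleton.P3 D) * (4 * ((D : ℝ) ^ 4 + 1) * bigT D ^ 4)
      ≤ bigP D := by
  have hℓ1 : 1 ≤ ell D := by linarith
  have hP : 0 < bigP D := Real.exp_pos _
  have hT0 : 0 < bigT D := Real.exp_pos _
  have hD3 : (3 : ℝ) ≤ D := by exact_mod_cast hD
  have hD0 : (0 : ℝ) < D := by linarith
  -- `max(P₂,P₃) = P₂` and `P^{1/2}P₂ = PT⁻¹⁰`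
  have hmax : max (Skeleton.P2 D) (Skeleton.P3 D) = Skeleton.P2 D :=
    max_eq_left (P3_le_P2_of_four_le hℓ)
  have hA : bigP D ^ (1 / 2 : ℝ) * Skeleton.P2 D = bigP D / bigT D ^ 10 := by
    rw [Skeleton.P2, show (0.5 : ℝ) = 1 / 2 by norm_num, mul_div_assoc', ← Real.rpow_add hP]
    norm_num
  -- `D ≤ T` (`T = e^{𝓛^{1.1}} ≥ e^{𝓛} = D`)
  have hDT : (D : ℝ) ≤ bigT D := by
    have hDexp : (D : ℝ) = Real.exp (ell D) := by rw [ell, Real.exp_log hD0]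
    rw [hDexp, bigT, Real.exp_le_exp]
    exact Real.self_le_rpow_of_one_le hℓ1 (by norm_num)
  -- `4(D⁴+1) ≤ D⁶ ≤ T⁶`
  have h4 : 4 * ((D : ℝ) ^ 4 + 1) ≤ bigT D ^ 6 := by
    have hD2 : (9 : ℝ) ≤ (D : ℝ) ^ 2 := by nlinarith
    have hD4 : (1 : ℝ) ≤ (D : ℝ) ^ 4 := one_le_pow₀ (by linarith)
    calc 4 * ((D : ℝ) ^ 4 + 1) ≤ (D : ℝ) ^ 4 * (D : ℝ) ^ 2 := by nlinarith
      _ = (D : ℝ) ^ 6 := by ring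
      _ ≤ bigT D ^ 6 := pow_le_pow_left₀ hD0.le hDT 6
  rw [hmax, hA]
  calc bigP D / bigT D ^ 10 * (4 * ((D : ℝ) ^ 4 + 1) * bigT D ^ 4)
      ≤ bigP D / bigT D ^ 10 * (bigT D ^ 6 * bigT D ^ 4) :=
        mul_le_mul_of_nonneg_left (mul_le_mul_of_nonneg_right h4 (by positivity)) (by positivity)
    _ = bigP D := by field_simp

omit χ in
/-- A Dirichlet convolution of two sequences vanishing from real thresholds `A`, `B` on vanishes from
`AB` on (cf. the private `convolution_eq_zero_of_support` of `TypedSection17NuStarBound`). [folklore] -/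
private theorem convolution_eq_zero_of_real_support {u v : ℕ → ℂ} {A B : ℝ}
    (hu : ∀ a : ℕ, A ≤ (a : ℝ) → u a = 0) (hv : ∀ b : ℕ, B ≤ (b : ℝ) → v b = 0) {n : ℕ}
    (hn : A * B ≤ (n : ℝ)) : (u ⍟ v) n = 0 := by
  rw [LSeries.convolution_def]
  refine Finset.sum_eq_zero fun q hq => ?_
  by_contra hne
  have ha : (q.1 : ℝ) < A := by
    by_contra h; exact (left_ne_zero_of_mul hne) (hu _ (not_lt.mp h))
  have hb : (q.2 : ℝ) < B := by
    by_contra h; exact (right_ne_zero_of_mul hne) (hv _ (not_lt.mp h))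
  have hqn : (q.1 : ℝ) * q.2 = n := by exact_mod_cast (Nat.mem_divisorsAntidiagonal.mp hq).1
  have : (q.1 : ℝ) * q.2 < A * B := mul_lt_mul'' ha hb (Nat.cast_nonneg _) (Nat.cast_nonneg _)
  linarith

/-- **`((bχ) ∗ ν₁*)(n) = 0` for `n > ⌊P⌋`** once `D ≥ 3`, `𝓛 ≥ 4` (the twisted coefficient of `B·G·N·N`
lives below `P`, so Lemma 3.3 (i) applies). [cite: Zhang2022LandauSiegel, §17 (17.8) p.98; §3 Lemma 3.3] -/
theorem bcoefChi_conv_nuOneStar_eq_zero_of_floor_lt (hD : 3 ≤ D) (hℓ : 4 ≤ ell D) {n : ℕ}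
    (hn : ⌊bigP D⌋₊ < n) : ((fun n => bcoef D n * χ (n : ZMod D)) ⍟ nuOneStar c' χ) n = 0 := by
  have hPn : bigP D ≤ (n : ℝ) := (Nat.lt_of_floor_lt hn).le
  refine convolution_eq_zero_of_real_support
    (fun a ha => by rw [bcoef_eq_zero_of_sqrtP_mul_max_le ha, zero_mul])
    (fun b hb => nuOneStar_eq_zero_of_le c' χ hb) ((support_product_le_bigP hD hℓ).trans hPn)

/-- **`B(s,ψ)G(s,ψ)N(s+β₂,ψ)N(s+β₃,ψ) = Σ_{1≤n≤⌊P⌋} ((bχ)∗ν₁*)(n)ψ(n)n^{−s}`** for every `ψ ∈ Ψ` and `s`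
(`D ≥ 3`, `𝓛 ≥ 4`): §17.u015 in its χ-twisted form (`step17_u015_chi`) with the sum cut at `⌊P⌋`.
[cite: Zhang2022LandauSiegel, §17 u015 p.97] -/
theorem BGNN_eq_sum_Icc [NeZero D] (hD : 3 ≤ D) (hℓ : 4 ≤ ell D) (x : Chr D) (s : ℂ) :
    Bpoly χ x s * Gpoly χ x s * Nchar D (psiFn x) (s + beta2 c' D) *
        Nchar D (psiFn x) (s + beta3 c' D) =
      ∑ n ∈ Icc 1 ⌊bigP D⌋₊, ((fun n => bcoef D n * χ (n : ZMod D)) ⍟ nuOneStar c' χ) n *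
        x.ψ (n : ZMod x.p) * (n : ℂ) ^ (-s) := by
  rw [step17_u015_chi c' χ x s, tsum_eq_sum (s := Icc 1 ⌊bigP D⌋₊)]
  intro n hn
  rcases Nat.eq_zero_or_pos n with rfl | hpos
  · simp [LSeries.convolution_map_zero]
  · have hgt : ⌊bigP D⌋₊ < n := by
      by_contra h
      exact hn (Finset.mem_Icc.mpr ⟨hpos, not_lt.mp h⟩)
    rw [bcoefChi_conv_nuOneStar_eq_zero_of_floor_lt c' χ hD hℓ hgt, zero_mul, zero_mul]

end Support

/-! ## The mean values over `ψ` (Lemma 3.3 (i), loss-free) -/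

section MeanValues

variable (c' : ℝ) {D : ℕ} [NeZero D] (χ : DirichletCharacter ℂ D)

omit [NeZero D] χ in
/-- `2 ≤ ⌊P⌋`, `2 ≤ ⌈2T²⌉`, `2 ≤ D⁴` for `D ≥ 3`, `𝓛 ≥ 1`. [cite: Zhang2022LandauSiegel, §2 (2.6)] -/
theorem sizes_two_le (hD : 3 ≤ D) (hℓ : 1 ≤ ell D) :
    2 ≤ ⌊bigP D⌋₊ ∧ 2 ≤ ⌈2 * bigT D ^ 2⌉₊ ∧ 2 ≤ D ^ 4 := by
  refine ⟨?_, ?_, ?_⟩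
  · refine Nat.le_floor ?_
    have : (2 : ℝ) ≤ Real.exp 1 := by have := Real.add_one_le_exp (1 : ℝ); linarith
    have h1 : Real.exp 1 ≤ bigP D := by
      rw [bigP]; exact Real.exp_le_exp.mpr (by nlinarith [one_le_pow₀ (M₀ := ℝ) hℓ (n := 9)])
    push_cast; linarith
  · have hT0 : 0 ≤ ell D ^ (1.1 : ℝ) := Real.rpow_nonneg (by linarith) _
    have hT : (1 : ℝ) ≤ bigT D ^ 2 := one_le_pow₀ (by rw [bigT]; exact Real.one_le_exp hT0)
    have h2 : ((2 : ℕ) : ℝ) ≤ ⌈2 * bigT D ^ 2⌉₊ :=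
      le_trans (by push_cast; linarith) (Nat.le_ceil _)
    exact_mod_cast h2
  · calc 2 ≤ 3 ^ 4 := by norm_num
      _ ≤ D ^ 4 := Nat.pow_le_pow_left hD 4

/-- **Mean square of `B·G·N·N` over any finite `T ⊆ Ψ` near the critical line** (`|Re s − ½| ≤ 2α`,
`D ≥ 3`, `𝓛 ≥ 4`): `Σ_{ψ∈T}|B(s,ψ)G(s,ψ)N(s+β₂,ψ)N(s+β₃,ψ)|² ≤
e^{8π}𝔓·K_ι²·majorantConst 36 14·(log⌊P⌋)⁴(log⌈2T²⌉)²⁰(log D⁴)¹²` — Lemma 3.3 (i) (loss-free) and the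
block mean square of `(bχ)∗ν₁*`. [cite: Zhang2022LandauSiegel, §17 p.97; §3 Lemma 3.3 p.12] -/
theorem meanSq_BGNN_le (hD : 3 ≤ D) (hℓ : 4 ≤ ell D) (T : Finset (Chr D)) {s : ℂ}
    (hs : |s.re - 1 / 2| ≤ 2 * alpha D) :
    ∑ x ∈ T, ‖Bpoly χ x s * Gpoly χ x s * Nchar D (psiFn x) (s + beta2 c' D) *
        Nchar D (psiFn x) (s + beta3 c' D)‖ ^ 2 ≤
      Real.exp (8 * π) * frakP D * (((1 + ‖iota2‖) * (‖iota3‖ + ‖iota4‖)) ^ 2 *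
        (majorantConst 36 14 * (Real.log ⌊bigP D⌋₊ ^ 4 * Real.log ⌈2 * bigT D ^ 2⌉₊ ^ 20 *
          Real.log ((D ^ 4 : ℕ) : ℝ) ^ 12))) := by
  have hℓ1 : 1 ≤ ell D := by linarith
  have hlog2 : 2 ≤ Real.log D := by rw [← ell]; linarith
  obtain ⟨hP2, hy2, hD42⟩ := sizes_two_le hD hℓ1
  set c : ℕ → ℂ := (fun n => bcoef D n * χ (n : ZMod D)) ⍟ nuOneStar c' χ with hc
  have hrw : ∀ x ∈ T, ‖Bpoly χ x s * Gpoly χ x s * Nchar D (psiFn x) (s + beta2 c' D) *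
      Nchar D (psiFn x) (s + beta3 c' D)‖ ^ 2 =
      ‖∑ n ∈ Icc 1 ⌊bigP D⌋₊, c n * x.ψ (n : ZMod x.p) * (n : ℂ) ^ (-s)‖ ^ 2 := by
    intro x _; rw [BGNN_eq_sum_Icc c' χ hD hℓ x s]
  rw [Finset.sum_congr rfl hrw]
  have hP0 : 0 ≤ Real.exp (8 * π) * frakP D := by
    have : 0 ≤ frakP D := by
      rw [frakP_eq_sum_primeWindow]; exact Finset.sum_nonneg fun p _ => Nat.cast_nonneg p
    positivity
  calc ∑ x ∈ T, ‖∑ n ∈ Icc 1 ⌊bigP D⌋₊, c n * x.ψ (n : ZMod x.p) * (n : ℂ) ^ (-s)‖ ^ 2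
      ≤ Real.exp (8 * π) * frakP D * ∑ n ∈ Icc 1 ⌊bigP D⌋₊, ‖c n‖ ^ 2 / n :=
        Typed.Section13.meanSq_floorP_le hℓ1 T hs c
    _ ≤ _ := mul_le_mul_of_nonneg_left
        (sum_norm_sq_bcoefChi_conv_nuOneStar_div_le c' χ hlog2 (by linarith) hD42 hy2 hP2) hP0

omit [NeZero D] in
/-- `conj(n^z) = n^{conj z}` for a natural number `n`. [folklore] -/
private theorem conj_natCast_cpow (n : ℕ) (z : ℂ) : conj ((n : ℂ) ^ z) = (n : ℂ) ^ conj z := by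
  have h := Complex.cpow_conj (n : ℂ) z (by rw [Complex.natCast_arg]; exact Real.pi_ne_zero.symm)
  rw [h, Complex.conj_natCast]

omit [NeZero D] in
/-- `F(w,ψ̄)` is, in norm, the `ψ`-polynomial with coefficients `conj ν(n)·[n ≤ D⁴]` at `conj w`,
extended by zero to `n ≤ ⌊P⌋` (`D⁴ ≤ ⌊P⌋`). [cite: Zhang2022LandauSiegel, §4 Lemma 4.4; §3 p.12] -/
theorem norm_FpolyBar_eq_norm_sum_Icc (x : Chr D) (w : ℂ) (hDP : D ^ 4 ≤ ⌊bigP D⌋₊) :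
    ‖FpolyBar χ x w‖ =
      ‖∑ n ∈ Icc 1 ⌊bigP D⌋₊, (if n ≤ D ^ 4 then conj (nu χ n) else 0) *
        x.ψ (n : ZMod x.p) * (n : ℂ) ^ (-conj w)‖ := by
  rw [← Complex.norm_conj, FpolyBar, map_sum]
  congr 1
  have hsub : Icc 1 (D ^ 4) ⊆ Icc 1 ⌊bigP D⌋₊ := Finset.Icc_subset_Icc_right hDP
  rw [← Finset.sum_subset hsub]
  · refine Finset.sum_congr rfl fun n hn => ?_
    have hnD : n ≤ D ^ 4 := (Finset.mem_Icc.mp hn).2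
    rw [if_pos hnD, map_mul, map_mul, Complex.conj_conj, conj_natCast_cpow, map_neg]
  · intro n _ hn
    have hnD : ¬ n ≤ D ^ 4 := fun h => hn (Finset.mem_Icc.mpr ⟨(Finset.mem_Icc.mp ‹n ∈ Icc 1 ⌊bigP D⌋₊›).1, h⟩)
    rw [if_neg hnD, zero_mul, zero_mul]

omit [NeZero D] in
/-- **Mean square of `F(w,ψ̄)` over any finite `T ⊆ Ψ` near the critical line** (`|Re w − ½| ≤ 2α`,
`D⁴ ≤ ⌊P⌋`, `𝓛 ≥ 1`): `Σ_{ψ∈T}|F(w,ψ̄)|² ≤ e^{8π}𝔓·majorantConst 4 4·(log⌊P⌋)⁴` (`ν ≪ τ₂`, (3.1)).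
[cite: Zhang2022LandauSiegel, §3 (3.1), Lemma 3.3 p.12] -/
theorem meanSq_FpolyBar_le (hℓ1 : 1 ≤ ell D) (hDP : D ^ 4 ≤ ⌊bigP D⌋₊) (hP2 : 2 ≤ ⌊bigP D⌋₊)
    (T : Finset (Chr D)) {w : ℂ} (hw : |w.re - 1 / 2| ≤ 2 * alpha D) :
    ∑ x ∈ T, ‖FpolyBar χ x w‖ ^ 2 ≤
      Real.exp (8 * π) * frakP D * (1 ^ 2 * (majorantConst 4 4 * Real.log ⌊bigP D⌋₊ ^ 4)) := by
  set c : ℕ → ℂ := fun n => if n ≤ D ^ 4 then conj (nu χ n) else 0 with hc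
  have hrw : ∀ x ∈ T, ‖FpolyBar χ x w‖ ^ 2 =
      ‖∑ n ∈ Icc 1 ⌊bigP D⌋₊, c n * x.ψ (n : ZMod x.p) * (n : ℂ) ^ (-conj w)‖ ^ 2 := by
    intro x _; rw [norm_FpolyBar_eq_norm_sum_Icc χ x w hDP]
  rw [Finset.sum_congr rfl hrw]
  have hw' : |(conj w).re - 1 / 2| ≤ 2 * alpha D := by rwa [Complex.conj_re]
  have hdom : Dom c 1 (tau 2) := by
    intro n _
    show ‖(if n ≤ D ^ 4 then conj (nu χ n) else 0)‖ ≤ 1 * tau 2 n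
    rw [one_mul]
    split_ifs
    · rw [Complex.norm_conj]; exact Lemma34.norm_nu_le χ n
    · rw [norm_zero]; exact tau_nonneg 2 n
  have hP0 : 0 ≤ Real.exp (8 * π) * frakP D := by
    have : 0 ≤ frakP D := by
      rw [frakP_eq_sum_primeWindow]; exact Finset.sum_nonneg fun p _ => Nat.cast_nonneg p
    positivity
  calc ∑ x ∈ T, ‖∑ n ∈ Icc 1 ⌊bigP D⌋₊, c n * x.ψ (n : ZMod x.p) * (n : ℂ) ^ (-conj w)‖ ^ 2
      ≤ Real.exp (8 * π) * frakP D * ∑ n ∈ Icc 1 ⌊bigP D⌋₊, ‖c n‖ ^ 2 / n :=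
        Typed.Section13.meanSq_floorP_le hℓ1 T hw' c
    _ ≤ _ := mul_le_mul_of_nonneg_left (Typed.Section13.sum_norm_sq_div_le_of_dom_tau_two hdom hP2) hP0

omit [NeZero D] χ in
/-- Cauchy–Schwarz over a finite family: `Σ a·b ≤ √(Σ a²)·√(Σ b²)` for nonnegative reals. [folklore] -/
private theorem sum_mul_le_sqrt_mul_sqrt {ι : Type*} (T : Finset ι) (a b : ι → ℝ) :
    ∑ i ∈ T, a i * b i ≤ Real.sqrt (∑ i ∈ T, a i ^ 2) * Real.sqrt (∑ i ∈ T, b i ^ 2) := by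
  rw [← Real.sqrt_mul (Finset.sum_nonneg fun i _ => sq_nonneg (a i))]
  refine Real.le_sqrt_of_sq_le ?_
  exact Finset.sum_mul_sq_le_sq_mul_sq T a b

/-- **The mean value consumed by §17.u011**: for any finite `T ⊆ Ψ`, `|Re s − ½| ≤ 2α`,
`|Re w − ½| ≤ 2α` (`D ≥ 3`, `𝓛 ≥ 4`, `D⁴ ≤ ⌊P⌋`),
`Σ_{ψ∈T} |B(s,ψ)G(s,ψ)N(s+β₂,ψ)N(s+β₃,ψ)|·|F(w,ψ̄)| ≤
e^{8π}𝔓·√(K_ι²·majorantConst 36 14·(log⌊P⌋)⁴(log⌈2T²⌉)²⁰(log D⁴)¹² · majorantConst 4 4·(log⌊P⌋)⁴)` —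
Cauchy–Schwarz on the two loss-free mean squares. [cite: Zhang2022LandauSiegel, §17 p.97; §3 Lemma 3.3] -/
theorem sum_norm_BGNN_mul_FpolyBar_le (hD : 3 ≤ D) (hℓ : 4 ≤ ell D) (hDP : D ^ 4 ≤ ⌊bigP D⌋₊)
    (T : Finset (Chr D)) {s w : ℂ} (hs : |s.re - 1 / 2| ≤ 2 * alpha D)
    (hw : |w.re - 1 / 2| ≤ 2 * alpha D) :
    ∑ x ∈ T, ‖Bpoly χ x s * Gpoly χ x s * Nchar D (psiFn x) (s + beta2 c' D) *
        Nchar D (psiFn x) (s + beta3 c' D)‖ * ‖FpolyBar χ x w‖ ≤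
      Real.exp (8 * π) * frakP D *
        Real.sqrt ((((1 + ‖iota2‖) * (‖iota3‖ + ‖iota4‖)) ^ 2 *
            (majorantConst 36 14 * (Real.log ⌊bigP D⌋₊ ^ 4 * Real.log ⌈2 * bigT D ^ 2⌉₊ ^ 20 *
              Real.log ((D ^ 4 : ℕ) : ℝ) ^ 12))) *
          (majorantConst 4 4 * Real.log ⌊bigP D⌋₊ ^ 4)) := by
  have hℓ1 : 1 ≤ ell D := by linarith
  obtain ⟨hP2, -, -⟩ := sizes_two_le hD hℓ1
  set A : ℝ := ((1 + ‖iota2‖) * (‖iota3‖ + ‖iota4‖)) ^ 2 *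
    (majorantConst 36 14 * (Real.log ⌊bigP D⌋₊ ^ 4 * Real.log ⌈2 * bigT D ^ 2⌉₊ ^ 20 *
      Real.log ((D ^ 4 : ℕ) : ℝ) ^ 12)) with hA
  set Bc : ℝ := majorantConst 4 4 * Real.log ⌊bigP D⌋₊ ^ 4 with hBc
  have hP0 : 0 ≤ frakP D := by
    rw [frakP_eq_sum_primeWindow]; exact Finset.sum_nonneg fun p _ => Nat.cast_nonneg p
  have hE : 0 ≤ Real.exp (8 * π) * frakP D := by positivity
  have hM1 := majorantConst_pos 36 14
  have hM2 := majorantConst_pos 4 4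
  have hA0 : 0 ≤ A := by rw [hA]; positivity
  have h1 := meanSq_BGNN_le c' χ hD hℓ T hs
  have h2 := meanSq_FpolyBar_le χ hℓ1 hDP hP2 T hw
  rw [one_pow, one_mul] at h2
  refine (sum_mul_le_sqrt_mul_sqrt T _ _).trans ?_
  calc Real.sqrt (∑ x ∈ T, ‖Bpoly χ x s * Gpoly χ x s * Nchar D (psiFn x) (s + beta2 c' D) *
          Nchar D (psiFn x) (s + beta3 c' D)‖ ^ 2) * Real.sqrt (∑ x ∈ T, ‖FpolyBar χ x w‖ ^ 2)
      ≤ Real.sqrt (Real.exp (8 * π) * frakP D * A) * Real.sqrt (Real.exp (8 * π) * frakP D * Bc) :=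
        mul_le_mul (Real.sqrt_le_sqrt h1) (Real.sqrt_le_sqrt h2) (Real.sqrt_nonneg _)
          (Real.sqrt_nonneg _)
    _ = Real.exp (8 * π) * frakP D * Real.sqrt (A * Bc) := by
        rw [← Real.sqrt_mul (mul_nonneg hE hA0), show Real.exp (8 * π) * frakP D * A *
          (Real.exp (8 * π) * frakP D * Bc) = (Real.exp (8 * π) * frakP D) ^ 2 * (A * Bc) by ring,
          Real.sqrt_mul (sq_nonneg _), Real.sqrt_sq hE]

end MeanValues

end Literature.NumberTheory.LFunctions.Zhang2022.Typed.Section17
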